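import Literature.NumberTheory.Rogawski1990.LocalTransferAdmissibleFamilies
import Literature.NumberTheory.Rogawski1990.TestFunctions
import Literature.NumberTheory.Automorphic.LocalUnitaryGroupSimilitudeLevel
import HarnessLib

/-!
# (14.2.1) CERTIFIED at every finite place for the inner form's own `ψ_v` and admissible measures
(Rogawski (1990), §14.1–14.2 pp. 232–233: «we fix an inner isomorphism `ψ : G′ → G`», «if `v ∉ S`, (14.2.1) is obviously satisfied» — and for
`D = M₃(E)` the set `S` is EMPTY; Gelbart (1975), §10 pp. 154–155)

Topic `NumberTheory/Rogawski1990`; namespace `Literature.NumberTheory.Rogawski1990`. THEOREMS ONLY (no definition, no named fact, no instance,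
no notation). The (L6c) certification brick of the cell `hodgecm-mathlib` (ENGINE T1, line `F0_T1InnerFormTraceIdentity`), composing
* ★ (L6b) `OrbitalMeasureFamily.transport`, `isLocalInnerTransfer_transport` (F0P3a-p03): `f_v := f′_v ∘ ψ_v⁻¹` satisfies (14.2.1) for the
  transported measures once `ψ_v` is class-preserving;
* ★ `OrbitalMeasureFamily.IsAdmissibleOn.transport` (A-p06): admissibility on prescribed classes transports along `ψ_v`;
* ★ `exists_isAdmissibleOn_isRegularElt_of_three_le` (A-p06): an admissible-on-regular-classes family exists on `U(H)(L⁺_v)`;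
* ★ (Ψ⁺) `UnitaryGroup.exists_psi_corresponds_forall_levelMatching` (F0P3a-p01, S2⁺⁺): ONE family `ψ_v`, class-preserving both ways at every
  finite place and level-preserving off a finite `S₀`;
into the statement the line pins as (ix′): for the anchored kit's `ψ` there are orbital measure families `m′_v` on `U(H)(L⁺_v)` and `m_v` on
`U(Φ₃)(L⁺_v)`, BOTH admissible on the regular classes, such that for every pair of pure tensors with `T′_v = T_v ∘ ψ_v⁻¹` (the line's pin (ix))
the local transfer identity (14.2.1) `IsLocalInnerTransfer L H v (m′ v) (m v) (T.loc v) (T′.loc v)` HOLDS AT EVERY finite `v`.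

* `isRegularElt_iff_of_isConj_local`, `isAdmissibleOn_isRegularElt_transport` — regularity is a class function on `U(H)(L⁺_v)` and is preserved by a
  class-preserving `ψ_v`, so `ψ_* m′` is admissible on the regular classes when `m′` is;
* `isLocalInnerTransfer_of_loc_eq_comp_symm` — (14.2.1) for `f_v = f′_v ∘ ψ_v⁻¹` given as an EQUATION (the token shape of pin (ix));
* `exists_measures_isLocalInnerTransfer` (for a given class-preserving family `ψ`) and `exists_psi_measures_isLocalInnerTransfer` (with the (Ψ⁺)
  family) — the packaged (ix′) inhabitants.

## References
* J. Rogawski, Ann. of Math. Stud. 123 (1990), §14.1–14.2 pp. 232–233 (print) [Rogawski1990].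
* S. Gelbart, *Automorphic forms on adele groups* (1975), §10 pp. 154–155 [Gelbart1975].
-/

set_option autoImplicit false

noncomputable section

open MeasureTheory NumberField IsDedekindDomain Topology
open scoped Matrix MatrixGroups

namespace Literature.NumberTheory.Rogawski1990

open Literature.MeasureTheory.Group Literature.NumberTheory.Automorphic
open Literature.AlgebraicGeometry.ShimuraVarieties (hermForm)

variable (L : Type) [Field L] [NumberField L] [IsCMField L]

/-! ## §1 One place: regular classes transport, (14.2.1) for `f_v = f′_v ∘ ψ_v⁻¹` -/

section OnePlace

variable {N : ℕ} (H : Matrix (Fin N) (Fin N) L) (H' : Matrix (Fin 3) (Fin 3) L) (v : HeightOneSpectrum (𝓞 ↥(maximalRealSubfield L)))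

/-- Regularity (separable characteristic polynomial) is a CLASS FUNCTION on `U(H)(L⁺_v)`: conjugate elements of the local unitary group are
conjugate in `GL_N(L ⊗ L⁺_v)` (★ `isRegularElt_of_isConj`). [cite: Rogawski1990, §14.2 p. 232] -/
theorem isRegularElt_iff_of_isConj_local {b b' : (UnitaryGroup.cmDatum L N H).Local v} (h : IsConj b b') :
    IsRegularElt (b.val : GL (Fin N) (UnitaryGroup.LocalRing L v)) ↔ IsRegularElt (b'.val : GL (Fin N) (UnitaryGroup.LocalRing L v)) := by
  have hGL : IsConj b.val b'.val := (UnitaryGroup.«local» L (IsCMField.complexConj L) N H v).subtype.map_isConj h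
  exact ⟨isRegularElt_of_isConj hGL, isRegularElt_of_isConj hGL.symm⟩

/-- **`ψ_* m′` is admissible on the REGULAR classes of `U(Φ₃)(L⁺_v)`** when `m′` is admissible on the regular classes of `U(H′)(L⁺_v)` and
`ψ_v⁻¹ γ ↔ γ` for every `γ` (class preservation of the inverse identification; ★ `IsAdmissibleOn.transport`). [cite: Rogawski1990, §14.2 (14.2.1) p. 232]
[cite: Gelbart1975, §10 pp. 154–155] -/
theorem isAdmissibleOn_isRegularElt_transport
    [∀ γ : (UnitaryGroup.cmDatum L 3 H').Local v,
      MeasurableSpace ((UnitaryGroup.cmDatum L 3 H').Local v ⧸ Subgroup.centralizer ({γ} : Set ((UnitaryGroup.cmDatum L 3 H').Local v)))]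
    [∀ γ : (UnitaryGroup.cmDatum L 3 H').Local v,
      BorelSpace ((UnitaryGroup.cmDatum L 3 H').Local v ⧸ Subgroup.centralizer ({γ} : Set ((UnitaryGroup.cmDatum L 3 H').Local v)))]
    [∀ γ : (UnitaryGroup.cmDatum L 3 (Matrix.of fun i j : Fin 3 => if i.val + j.val + 1 = 3 then (1 : L) else 0)).Local v,
      MeasurableSpace ((UnitaryGroup.cmDatum L 3 (Matrix.of fun i j : Fin 3 => if i.val + j.val + 1 = 3 then (1 : L) else 0)).Local v ⧸
        Subgroup.centralizer ({γ} : Set ((UnitaryGroup.cmDatum L 3 (Matrix.of fun i j : Fin 3 => if i.val + j.val + 1 = 3 then (1 : L) else 0)).Local v)))]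
    [∀ γ : (UnitaryGroup.cmDatum L 3 (Matrix.of fun i j : Fin 3 => if i.val + j.val + 1 = 3 then (1 : L) else 0)).Local v,
      BorelSpace ((UnitaryGroup.cmDatum L 3 (Matrix.of fun i j : Fin 3 => if i.val + j.val + 1 = 3 then (1 : L) else 0)).Local v ⧸
        Subgroup.centralizer ({γ} : Set ((UnitaryGroup.cmDatum L 3 (Matrix.of fun i j : Fin 3 => if i.val + j.val + 1 = 3 then (1 : L) else 0)).Local v)))]
    (ψ : (UnitaryGroup.cmDatum L 3 H').Local v ≃ₜ*
      (UnitaryGroup.cmDatum L 3 (Matrix.of fun i j : Fin 3 => if i.val + j.val + 1 = 3 then (1 : L) else 0)).Local v)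
    (hcl' : ∀ γ, Corresponds (UnitaryGroup.conjLocal L (IsCMField.complexConj L) v)
      ((UnitaryGroup.adelicForm L 3 H').map (UnitaryGroup.adeleToLocal L v))
      ((UnitaryGroup.adelicForm L 3 (Matrix.of fun i j : Fin 3 => if i.val + j.val + 1 = 3 then (1 : L) else 0)).map
        (UnitaryGroup.adeleToLocal L v)) (ψ.symm γ) γ)
    {m' : OrbitalMeasureFamily ((UnitaryGroup.cmDatum L 3 H').Local v)}
    (hm' : m'.IsAdmissibleOn fun γ => IsRegularElt (γ.val : GL (Fin 3) (UnitaryGroup.LocalRing L v))) :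
    (m'.transport ψ.toMulEquiv ψ.continuous ψ.symm.continuous).IsAdmissibleOn
      fun γ => IsRegularElt (γ.val : GL (Fin 3) (UnitaryGroup.LocalRing L v)) :=
  hm'.transport ψ.toMulEquiv ψ.continuous ψ.symm.continuous (fun _ _ h => isRegularElt_iff_of_isConj_local L H' v h)
    fun γ hγ => isRegularElt_of_isConj (hcl' γ).symm hγ

/-- **(14.2.1) at `v` for `f_v = f′_v ∘ ψ_v⁻¹` given as an equation** (the token shape of the line's pin (ix) `T′.loc v = T.loc v ∘ (ψ v).symm`):
★ `isLocalInnerTransfer_transport` for the transported measures. [cite: Rogawski1990, §14.2 (14.2.1) p. 232] -/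
theorem isLocalInnerTransfer_of_loc_eq_comp_symm
    [∀ γ : (UnitaryGroup.cmDatum L 3 H').Local v,
      MeasurableSpace ((UnitaryGroup.cmDatum L 3 H').Local v ⧸ Subgroup.centralizer ({γ} : Set ((UnitaryGroup.cmDatum L 3 H').Local v)))]
    [∀ γ : (UnitaryGroup.cmDatum L 3 H').Local v,
      BorelSpace ((UnitaryGroup.cmDatum L 3 H').Local v ⧸ Subgroup.centralizer ({γ} : Set ((UnitaryGroup.cmDatum L 3 H').Local v)))]
    [∀ γ : (UnitaryGroup.cmDatum L 3 (Matrix.of fun i j : Fin 3 => if i.val + j.val + 1 = 3 then (1 : L) else 0)).Local v,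
      MeasurableSpace ((UnitaryGroup.cmDatum L 3 (Matrix.of fun i j : Fin 3 => if i.val + j.val + 1 = 3 then (1 : L) else 0)).Local v ⧸
        Subgroup.centralizer ({γ} : Set ((UnitaryGroup.cmDatum L 3 (Matrix.of fun i j : Fin 3 => if i.val + j.val + 1 = 3 then (1 : L) else 0)).Local v)))]
    [∀ γ : (UnitaryGroup.cmDatum L 3 (Matrix.of fun i j : Fin 3 => if i.val + j.val + 1 = 3 then (1 : L) else 0)).Local v,
      BorelSpace ((UnitaryGroup.cmDatum L 3 (Matrix.of fun i j : Fin 3 => if i.val + j.val + 1 = 3 then (1 : L) else 0)).Local v ⧸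
        Subgroup.centralizer ({γ} : Set ((UnitaryGroup.cmDatum L 3 (Matrix.of fun i j : Fin 3 => if i.val + j.val + 1 = 3 then (1 : L) else 0)).Local v)))]
    (ψ : (UnitaryGroup.cmDatum L 3 H').Local v ≃ₜ*
      (UnitaryGroup.cmDatum L 3 (Matrix.of fun i j : Fin 3 => if i.val + j.val + 1 = 3 then (1 : L) else 0)).Local v)
    (hcl : ∀ γ', Corresponds (UnitaryGroup.conjLocal L (IsCMField.complexConj L) v)
      ((UnitaryGroup.adelicForm L 3 H').map (UnitaryGroup.adeleToLocal L v))
      ((UnitaryGroup.adelicForm L 3 (Matrix.of fun i j : Fin 3 => if i.val + j.val + 1 = 3 then (1 : L) else 0)).map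
        (UnitaryGroup.adeleToLocal L v)) γ' (ψ γ'))
    (m' : OrbitalMeasureFamily ((UnitaryGroup.cmDatum L 3 H').Local v)) {f' : (UnitaryGroup.cmDatum L 3 H').Local v → ℂ}
    {f : (UnitaryGroup.cmDatum L 3 (Matrix.of fun i j : Fin 3 => if i.val + j.val + 1 = 3 then (1 : L) else 0)).Local v → ℂ}
    (hf : f = f' ∘ ψ.symm) :
    IsLocalInnerTransfer L H' v m' (m'.transport ψ.toMulEquiv ψ.continuous ψ.symm.continuous) f' f := by
  rw [hf]
  exact isLocalInnerTransfer_transport L H' v ψ hcl m' f'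

end OnePlace

/-! ## §2 All finite places at once: the (ix′) inhabitants -/

section AllPlaces

variable (H : Matrix (Fin 3) (Fin 3) L)
  [∀ v : HeightOneSpectrum (𝓞 ↥(maximalRealSubfield L)), MeasurableSpace ((UnitaryGroup.cmDatum L 3 H).Local v)]
  [∀ v : HeightOneSpectrum (𝓞 ↥(maximalRealSubfield L)), BorelSpace ((UnitaryGroup.cmDatum L 3 H).Local v)]
  [∀ (v : HeightOneSpectrum (𝓞 ↥(maximalRealSubfield L))) (γ : (UnitaryGroup.cmDatum L 3 H).Local v),
    MeasurableSpace ((UnitaryGroup.cmDatum L 3 H).Local v ⧸ Subgroup.centralizer ({γ} : Set ((UnitaryGroup.cmDatum L 3 H).Local v)))]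
  [∀ (v : HeightOneSpectrum (𝓞 ↥(maximalRealSubfield L))) (γ : (UnitaryGroup.cmDatum L 3 H).Local v),
    BorelSpace ((UnitaryGroup.cmDatum L 3 H).Local v ⧸ Subgroup.centralizer ({γ} : Set ((UnitaryGroup.cmDatum L 3 H).Local v)))]
  [∀ (v : HeightOneSpectrum (𝓞 ↥(maximalRealSubfield L)))
    (γ : (UnitaryGroup.cmDatum L 3 (Matrix.of fun i j : Fin 3 => if i.val + j.val + 1 = 3 then (1 : L) else 0)).Local v),
    MeasurableSpace ((UnitaryGroup.cmDatum L 3 (Matrix.of fun i j : Fin 3 => if i.val + j.val + 1 = 3 then (1 : L) else 0)).Local v ⧸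
      Subgroup.centralizer ({γ} : Set ((UnitaryGroup.cmDatum L 3 (Matrix.of fun i j : Fin 3 => if i.val + j.val + 1 = 3 then (1 : L) else 0)).Local v)))]
  [∀ (v : HeightOneSpectrum (𝓞 ↥(maximalRealSubfield L)))
    (γ : (UnitaryGroup.cmDatum L 3 (Matrix.of fun i j : Fin 3 => if i.val + j.val + 1 = 3 then (1 : L) else 0)).Local v),
    BorelSpace ((UnitaryGroup.cmDatum L 3 (Matrix.of fun i j : Fin 3 => if i.val + j.val + 1 = 3 then (1 : L) else 0)).Local v ⧸
      Subgroup.centralizer ({γ} : Set ((UnitaryGroup.cmDatum L 3 (Matrix.of fun i j : Fin 3 => if i.val + j.val + 1 = 3 then (1 : L) else 0)).Local v)))]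

/-- **(ix′) for a GIVEN class-preserving family `ψ`.** `H ∈ M₃(L)` hermitian non-degenerate; `ψ_v : U(H)(L⁺_v) ≃ₜ* U(Φ₃)(L⁺_v)` with `γ′ ↔ ψ_v γ′` and
`ψ_v⁻¹ γ ↔ γ` at every finite `v`. Then there are orbital measure families `m′_v` on `U(H)(L⁺_v)` and `m_v` on `U(Φ₃)(L⁺_v)`, both admissible on the
regular classes (`m′` by ★ `exists_isAdmissibleOn_isRegularElt_of_three_le`, `m := ψ_* m′`), such that (14.2.1) holds at EVERY finite `v` for every
pair of pure tensors with `T′_v = T_v ∘ ψ_v⁻¹`. [cite: Rogawski1990, §14.2 (14.2.1) p. 232] [cite: Gelbart1975, §10 pp. 154–155] -/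
theorem exists_measures_isLocalInnerTransfer (hherm : (H.map (cmConjRingHom L))ᵀ = H) (hdet : H.det ≠ 0)
    (ψ : ∀ v : HeightOneSpectrum (𝓞 ↥(maximalRealSubfield L)), (UnitaryGroup.cmDatum L 3 H).Local v ≃ₜ*
      (UnitaryGroup.cmDatum L 3 (Matrix.of fun i j : Fin 3 => if i.val + j.val + 1 = 3 then (1 : L) else 0)).Local v)
    (hcorr : ∀ v (γ' : (UnitaryGroup.cmDatum L 3 H).Local v),
      Corresponds (UnitaryGroup.conjLocal L (IsCMField.complexConj L) v) ((UnitaryGroup.adelicForm L 3 H).map (UnitaryGroup.adeleToLocal L v))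
        ((UnitaryGroup.adelicForm L 3 (Matrix.of fun i j : Fin 3 => if i.val + j.val + 1 = 3 then (1 : L) else 0)).map (UnitaryGroup.adeleToLocal L v))
        γ' (ψ v γ'))
    (hcorr' : ∀ v (γ : (UnitaryGroup.cmDatum L 3 (Matrix.of fun i j : Fin 3 => if i.val + j.val + 1 = 3 then (1 : L) else 0)).Local v),
      Corresponds (UnitaryGroup.conjLocal L (IsCMField.complexConj L) v) ((UnitaryGroup.adelicForm L 3 H).map (UnitaryGroup.adeleToLocal L v))
        ((UnitaryGroup.adelicForm L 3 (Matrix.of fun i j : Fin 3 => if i.val + j.val + 1 = 3 then (1 : L) else 0)).map (UnitaryGroup.adeleToLocal L v))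
        ((ψ v).symm γ) γ) :
    ∃ (m' : ∀ v, OrbitalMeasureFamily ((UnitaryGroup.cmDatum L 3 H).Local v))
      (m : ∀ v, OrbitalMeasureFamily ((UnitaryGroup.cmDatum L 3 (Matrix.of fun i j : Fin 3 => if i.val + j.val + 1 = 3 then (1 : L) else 0)).Local v)),
      (∀ v, (m' v).IsAdmissibleOn fun γ => IsRegularElt (γ.val : GL (Fin 3) (UnitaryGroup.LocalRing L v))) ∧
      (∀ v, (m v).IsAdmissibleOn fun γ => IsRegularElt (γ.val : GL (Fin 3) (UnitaryGroup.LocalRing L v))) ∧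
      ∀ (T : UnitaryGroup.PureTensor L 3 H)
        (T' : UnitaryGroup.PureTensor L 3 (Matrix.of fun i j : Fin 3 => if i.val + j.val + 1 = 3 then (1 : L) else 0)),
        (∀ v, T'.loc v = T.loc v ∘ (ψ v).symm) → ∀ v, IsLocalInnerTransfer L H v (m' v) (m v) (T.loc v) (T'.loc v) := by
  have hm' : ∀ v : HeightOneSpectrum (𝓞 ↥(maximalRealSubfield L)), ∃ m' : OrbitalMeasureFamily ((UnitaryGroup.cmDatum L 3 H).Local v),
      m'.IsAdmissibleOn fun γ => IsRegularElt (γ.val : GL (Fin 3) (UnitaryGroup.LocalRing L v)) :=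
    fun v => exists_isAdmissibleOn_isRegularElt_of_three_le L le_rfl H hherm hdet v
  choose m' hm' using hm'
  refine ⟨m', fun v => (m' v).transport (ψ v).toMulEquiv (ψ v).continuous (ψ v).symm.continuous, hm',
    fun v => isAdmissibleOn_isRegularElt_transport L H v (ψ v) (hcorr' v) (hm' v), fun T T' hloc v => ?_⟩
  exact isLocalInnerTransfer_of_loc_eq_comp_symm L H v (ψ v) (hcorr v) (m' v) (hloc v)

/-- **The (ix′) inhabitant for the inner form `G′ = U(H)`, `H` ANISOTROPIC hermitian** — print's (14.2.1) at EVERY finite place for the cell's own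
`ψ`: there are `ψ_v : U(H)(L⁺_v) ≃ₜ* U(Φ₃)(L⁺_v)` (all finite `v`), a finite `S₀`, and orbital measure families `m′`, `m` admissible on the regular
classes, such that `ψ` is class-preserving both ways and level-preserving off `S₀` (★ (Ψ⁺) `exists_psi_corresponds_forall_levelMatching`) and every
`ψ`-transported pair of pure tensors (`T′_v = T_v ∘ ψ_v⁻¹`) satisfies `IsLocalInnerTransfer L H v (m′ v) (m v) (T.loc v) (T′.loc v)` for all `v`
— «for `D = M₃(E)` the set `S` is empty … if `v ∉ S`, (14.2.1) is obviously satisfied» [Rogawski1990, §14.1–14.2]. (`det H ≠ 0` by ★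
`Godement.det_ne_zero_of_anisotropic`.) [cite: Rogawski1990, §14.2 (14.2.1) p. 232] [cite: Gelbart1975, §10 pp. 154–155] -/
theorem exists_psi_measures_isLocalInnerTransfer (hanis : ∀ x : Fin 3 → L, hermForm (cmConjRingHom L) H x x = 0 → x = 0)
    (hherm : (H.map (cmConjRingHom L))ᵀ = H) :
    ∃ (ψ : ∀ v : HeightOneSpectrum (𝓞 ↥(maximalRealSubfield L)), (UnitaryGroup.cmDatum L 3 H).Local v ≃ₜ*
        (UnitaryGroup.cmDatum L 3 (Matrix.of fun i j : Fin 3 => if i.val + j.val + 1 = 3 then (1 : L) else 0)).Local v)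
      (S₀ : Finset (HeightOneSpectrum (𝓞 ↥(maximalRealSubfield L))))
      (m' : ∀ v, OrbitalMeasureFamily ((UnitaryGroup.cmDatum L 3 H).Local v))
      (m : ∀ v, OrbitalMeasureFamily ((UnitaryGroup.cmDatum L 3 (Matrix.of fun i j : Fin 3 => if i.val + j.val + 1 = 3 then (1 : L) else 0)).Local v)),
      (∀ v (γ' : (UnitaryGroup.cmDatum L 3 H).Local v),
        Corresponds (UnitaryGroup.conjLocal L (IsCMField.complexConj L) v) ((UnitaryGroup.adelicForm L 3 H).map (UnitaryGroup.adeleToLocal L v))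
          ((UnitaryGroup.adelicForm L 3 (Matrix.of fun i j : Fin 3 => if i.val + j.val + 1 = 3 then (1 : L) else 0)).map (UnitaryGroup.adeleToLocal L v))
          γ' (ψ v γ')) ∧
      (∀ v (γ : (UnitaryGroup.cmDatum L 3 (Matrix.of fun i j : Fin 3 => if i.val + j.val + 1 = 3 then (1 : L) else 0)).Local v),
        Corresponds (UnitaryGroup.conjLocal L (IsCMField.complexConj L) v) ((UnitaryGroup.adelicForm L 3 H).map (UnitaryGroup.adeleToLocal L v))
          ((UnitaryGroup.adelicForm L 3 (Matrix.of fun i j : Fin 3 => if i.val + j.val + 1 = 3 then (1 : L) else 0)).map (UnitaryGroup.adeleToLocal L v))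
          ((ψ v).symm γ) γ) ∧
      (∀ v ∉ S₀, ∀ g, ψ v g ∈ UnitaryGroup.cmLocalIntegralLevel L 3 (Matrix.of fun i j : Fin 3 => if i.val + j.val + 1 = 3 then (1 : L) else 0) v ↔
        g ∈ UnitaryGroup.cmLocalIntegralLevel L 3 H v) ∧
      (∀ v, (m' v).IsAdmissibleOn fun γ => IsRegularElt (γ.val : GL (Fin 3) (UnitaryGroup.LocalRing L v))) ∧
      (∀ v, (m v).IsAdmissibleOn fun γ => IsRegularElt (γ.val : GL (Fin 3) (UnitaryGroup.LocalRing L v))) ∧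
      ∀ (T : UnitaryGroup.PureTensor L 3 H)
        (T' : UnitaryGroup.PureTensor L 3 (Matrix.of fun i j : Fin 3 => if i.val + j.val + 1 = 3 then (1 : L) else 0)),
        (∀ v, T'.loc v = T.loc v ∘ (ψ v).symm) → ∀ v, IsLocalInnerTransfer L H v (m' v) (m v) (T.loc v) (T'.loc v) := by
  obtain ⟨ψ, S₀, hcorr, hcorr', hlev⟩ := UnitaryGroup.exists_psi_corresponds_forall_levelMatching L H hanis hherm
  obtain ⟨m', m, hm', hm, htr⟩ := exists_measures_isLocalInnerTransfer L H hherm (Godement.det_ne_zero_of_anisotropic L H hanis) ψ hcorr hcorr'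
  exact ⟨ψ, S₀, m', m, hcorr, hcorr', hlev, hm', hm, htr⟩

end AllPlaces

/-! ## §3 (ed. 2) The transported family for a GIVEN `m′` — the (ix″) socket by name

[Rogawski1990, §14.2 p. 232] fixes the measures on `G′_v` and `G_v = U(Φ₃)(L⁺_v)` COMPATIBLY through `ψ_v` («we fix an inner isomorphism
`ψ : G′ → G` … if `v ∉ S`, (14.2.1) is obviously satisfied»); [Gelbart1975, §10 pp. 154–155] matches the orbital integrals class by class along
`G_S = G′_S`.  §2 hides the quasi-split family `m_v := (ψ_v)_* m′_v` inside an `∃`; the ENGINE-T1 kit (SPEC-ed1.18 §3 (ix″), PLAN-T1 (g3) §1 F1)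
carries its local families as DATA and pins the quasi-split one BY NAME as the transport of the inner form's:
`mq v := (mG v).transport (ψ v).toMulEquiv (ψ v).continuous (ψ v).symm.continuous` (★ `OrbitalMeasureFamily.transport`, no new definition).
This section states §2's conclusions for THAT family with `m′` GIVEN (no choice, no Haar measure on the groups — only the Borel structures of
the orbit quotients are instance hypotheses):

* `OrbitalMeasureFamily.transport_smul` ∕ `transport_pi_smul` — transport COMMUTES with rescaling (`(κ • m′).transport ψ = κ • m′.transport ψ`,
  scalar or class-by-class weight read through `preClass ψ`), so the rescaled-then-transported kit families of ★ `LocalTransferRescale` are the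
  transported-then-rescaled ones by name;
* `forall_isAdmissibleOn_isRegularElt_transport` — `ψ_* m′` is admissible on the regular classes at EVERY finite place when `m′` is;
* `forall_isLocalInnerTransfer_transport` — (14.2.1) at EVERY finite place for every `ψ`-transported pair of pure tensors, for ANY `m′`;
* `isAdmissibleOn_and_isLocalInnerTransfer_transport` — the two packaged as the body of §2's `exists_measures_isLocalInnerTransfer` with the
  existential witnesses made explicit (`m′ := m′`, `m := ψ_* m′`). -/

section TransportSmul

open scoped ENNReal

variable {A B : Type*} [Group A] [Group B] (ψ : B ≃* A) [TopologicalSpace A] [TopologicalSpace B] [IsTopologicalGroup A]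
  (hψ : Continuous ψ) (hψs : Continuous ψ.symm)
  [∀ a : A, MeasurableSpace (A ⧸ Subgroup.centralizer ({a} : Set A))] [∀ a : A, BorelSpace (A ⧸ Subgroup.centralizer ({a} : Set A))]
  [∀ b : B, MeasurableSpace (B ⧸ Subgroup.centralizer ({b} : Set B))] [∀ b : B, BorelSpace (B ⧸ Subgroup.centralizer ({b} : Set B))]

/-- **Transport commutes with a scalar rescaling**: `(κ • m′).transport ψ = κ • m′.transport ψ` for `κ : ℝ≥0∞` (push-forward of measures is
`ℝ≥0∞`-linear).  Dot-notation extension of ★ `OrbitalMeasureFamily.transport` (`Rogawski1990/LocalTransferTransport`), declared by absolute name.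
[cite: Rogawski1990, §14.2 p. 232] -/
theorem _root_.Literature.NumberTheory.Automorphic.OrbitalMeasureFamily.transport_smul (κ : ℝ≥0∞) (m' : OrbitalMeasureFamily B) :
    (κ • m').transport ψ hψ hψs = κ • m'.transport ψ hψ hψs := by
  funext c
  simp only [OrbitalMeasureFamily.transport, Pi.smul_apply, Measure.map_smul]

/-- **Transport commutes with a class-by-class rescaling**: `(κ • m′).transport ψ = (κ ∘ preClass ψ) • m′.transport ψ` for a weight
`κ : ConjClasses B → ℝ≥0∞` — the weight of the transported member at the class `c` of `A` is the weight of `m′` at `ψ⁻¹ c`.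
[cite: Rogawski1990, §14.2 p. 232] -/
theorem _root_.Literature.NumberTheory.Automorphic.OrbitalMeasureFamily.transport_pi_smul (κ : ConjClasses B → ℝ≥0∞)
    (m' : OrbitalMeasureFamily B) :
    (κ • m').transport ψ hψ hψs = (κ ∘ preClass ψ) • m'.transport ψ hψ hψs := by
  funext c
  simp only [OrbitalMeasureFamily.transport, Pi.smul_apply', Function.comp_apply, Measure.map_smul]

end TransportSmul

section GivenFamily

variable (H : Matrix (Fin 3) (Fin 3) L)
  [∀ (v : HeightOneSpectrum (𝓞 ↥(maximalRealSubfield L))) (γ : (UnitaryGroup.cmDatum L 3 H).Local v),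
    MeasurableSpace ((UnitaryGroup.cmDatum L 3 H).Local v ⧸ Subgroup.centralizer ({γ} : Set ((UnitaryGroup.cmDatum L 3 H).Local v)))]
  [∀ (v : HeightOneSpectrum (𝓞 ↥(maximalRealSubfield L))) (γ : (UnitaryGroup.cmDatum L 3 H).Local v),
    BorelSpace ((UnitaryGroup.cmDatum L 3 H).Local v ⧸ Subgroup.centralizer ({γ} : Set ((UnitaryGroup.cmDatum L 3 H).Local v)))]
  [∀ (v : HeightOneSpectrum (𝓞 ↥(maximalRealSubfield L)))
    (γ : (UnitaryGroup.cmDatum L 3 (Matrix.of fun i j : Fin 3 => if i.val + j.val + 1 = 3 then (1 : L) else 0)).Local v),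
    MeasurableSpace ((UnitaryGroup.cmDatum L 3 (Matrix.of fun i j : Fin 3 => if i.val + j.val + 1 = 3 then (1 : L) else 0)).Local v ⧸
      Subgroup.centralizer ({γ} : Set ((UnitaryGroup.cmDatum L 3 (Matrix.of fun i j : Fin 3 => if i.val + j.val + 1 = 3 then (1 : L) else 0)).Local v)))]
  [∀ (v : HeightOneSpectrum (𝓞 ↥(maximalRealSubfield L)))
    (γ : (UnitaryGroup.cmDatum L 3 (Matrix.of fun i j : Fin 3 => if i.val + j.val + 1 = 3 then (1 : L) else 0)).Local v),
    BorelSpace ((UnitaryGroup.cmDatum L 3 (Matrix.of fun i j : Fin 3 => if i.val + j.val + 1 = 3 then (1 : L) else 0)).Local v ⧸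
      Subgroup.centralizer ({γ} : Set ((UnitaryGroup.cmDatum L 3 (Matrix.of fun i j : Fin 3 => if i.val + j.val + 1 = 3 then (1 : L) else 0)).Local v)))]
  (ψ : ∀ v : HeightOneSpectrum (𝓞 ↥(maximalRealSubfield L)), (UnitaryGroup.cmDatum L 3 H).Local v ≃ₜ*
    (UnitaryGroup.cmDatum L 3 (Matrix.of fun i j : Fin 3 => if i.val + j.val + 1 = 3 then (1 : L) else 0)).Local v)

/-- **`ψ_* m′` is admissible on the regular classes at EVERY finite place** when each `m′_v` is and `ψ_v⁻¹ γ ↔ γ` for every `γ` (§1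
`isAdmissibleOn_isRegularElt_transport`, place by place) — the admissibility clause of the kit's pin (ix″) for
`mq v := (mG v).transport (ψ v) …`. [cite: Rogawski1990, §14.2 (14.2.1) p. 232] [cite: Gelbart1975, §10 pp. 154–155] -/
theorem forall_isAdmissibleOn_isRegularElt_transport
    (hcorr' : ∀ v (γ : (UnitaryGroup.cmDatum L 3 (Matrix.of fun i j : Fin 3 => if i.val + j.val + 1 = 3 then (1 : L) else 0)).Local v),
      Corresponds (UnitaryGroup.conjLocal L (IsCMField.complexConj L) v) ((UnitaryGroup.adelicForm L 3 H).map (UnitaryGroup.adeleToLocal L v))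
        ((UnitaryGroup.adelicForm L 3 (Matrix.of fun i j : Fin 3 => if i.val + j.val + 1 = 3 then (1 : L) else 0)).map (UnitaryGroup.adeleToLocal L v))
        ((ψ v).symm γ) γ)
    {m' : ∀ v, OrbitalMeasureFamily ((UnitaryGroup.cmDatum L 3 H).Local v)}
    (hm' : ∀ v, (m' v).IsAdmissibleOn fun γ => IsRegularElt (γ.val : GL (Fin 3) (UnitaryGroup.LocalRing L v))) :
    ∀ v, ((m' v).transport (ψ v).toMulEquiv (ψ v).continuous (ψ v).symm.continuous).IsAdmissibleOn
      fun γ => IsRegularElt (γ.val : GL (Fin 3) (UnitaryGroup.LocalRing L v)) :=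
  fun v => isAdmissibleOn_isRegularElt_transport L H v (ψ v) (hcorr' v) (hm' v)

/-- **(14.2.1) at EVERY finite place for the transported family, ANY `m′`**: if `γ′ ↔ ψ_v γ′` for every `γ′` then every pair of pure tensors
with `T′_v = T_v ∘ ψ_v⁻¹` at all finite `v` satisfies `IsLocalInnerTransfer L H v (m′ v) (ψ_* m′ v) (T.loc v) (T′.loc v)` (§1
`isLocalInnerTransfer_of_loc_eq_comp_symm`, place by place; no admissibility is used) — the transfer clause of the kit's pin (ix″).
[cite: Rogawski1990, §14.2 (14.2.1) p. 232] [cite: Gelbart1975, §10 pp. 154–155] -/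
theorem forall_isLocalInnerTransfer_transport
    (hcorr : ∀ v (γ' : (UnitaryGroup.cmDatum L 3 H).Local v),
      Corresponds (UnitaryGroup.conjLocal L (IsCMField.complexConj L) v) ((UnitaryGroup.adelicForm L 3 H).map (UnitaryGroup.adeleToLocal L v))
        ((UnitaryGroup.adelicForm L 3 (Matrix.of fun i j : Fin 3 => if i.val + j.val + 1 = 3 then (1 : L) else 0)).map (UnitaryGroup.adeleToLocal L v))
        γ' (ψ v γ'))
    (m' : ∀ v, OrbitalMeasureFamily ((UnitaryGroup.cmDatum L 3 H).Local v)) (T : UnitaryGroup.PureTensor L 3 H)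
    (T' : UnitaryGroup.PureTensor L 3 (Matrix.of fun i j : Fin 3 => if i.val + j.val + 1 = 3 then (1 : L) else 0))
    (hloc : ∀ v, T'.loc v = T.loc v ∘ (ψ v).symm) (v : HeightOneSpectrum (𝓞 ↥(maximalRealSubfield L))) :
    IsLocalInnerTransfer L H v (m' v) ((m' v).transport (ψ v).toMulEquiv (ψ v).continuous (ψ v).symm.continuous) (T.loc v) (T'.loc v) :=
  isLocalInnerTransfer_of_loc_eq_comp_symm L H v (ψ v) (hcorr v) (m' v) (hloc v)

/-- **§2's `exists_measures_isLocalInnerTransfer` with its witnesses made explicit**: for `ψ` class-preserving both ways and a GIVEN family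
`m′` admissible on the regular classes, the pair `(m′, ψ_* m′)` satisfies both clauses — `ψ_* m′` admissible on the regular classes at every
finite `v`, and (14.2.1) at every finite `v` for every `ψ`-transported pair of pure tensors.  (ED. 1.17 (D)
`ComparisonKit.IsPinned.exists_measures_isLocalInnerTransfer` with `m′ := mG`, `m := mq` and the `∃` gone.)
[cite: Rogawski1990, §14.2 (14.2.1) p. 232] [cite: Gelbart1975, §10 pp. 154–155] -/
theorem isAdmissibleOn_and_isLocalInnerTransfer_transport
    (hcorr : ∀ v (γ' : (UnitaryGroup.cmDatum L 3 H).Local v),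
      Corresponds (UnitaryGroup.conjLocal L (IsCMField.complexConj L) v) ((UnitaryGroup.adelicForm L 3 H).map (UnitaryGroup.adeleToLocal L v))
        ((UnitaryGroup.adelicForm L 3 (Matrix.of fun i j : Fin 3 => if i.val + j.val + 1 = 3 then (1 : L) else 0)).map (UnitaryGroup.adeleToLocal L v))
        γ' (ψ v γ'))
    (hcorr' : ∀ v (γ : (UnitaryGroup.cmDatum L 3 (Matrix.of fun i j : Fin 3 => if i.val + j.val + 1 = 3 then (1 : L) else 0)).Local v),
      Corresponds (UnitaryGroup.conjLocal L (IsCMField.complexConj L) v) ((UnitaryGroup.adelicForm L 3 H).map (UnitaryGroup.adeleToLocal L v))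
        ((UnitaryGroup.adelicForm L 3 (Matrix.of fun i j : Fin 3 => if i.val + j.val + 1 = 3 then (1 : L) else 0)).map (UnitaryGroup.adeleToLocal L v))
        ((ψ v).symm γ) γ)
    {m' : ∀ v, OrbitalMeasureFamily ((UnitaryGroup.cmDatum L 3 H).Local v)}
    (hm' : ∀ v, (m' v).IsAdmissibleOn fun γ => IsRegularElt (γ.val : GL (Fin 3) (UnitaryGroup.LocalRing L v))) :
    (∀ v, ((m' v).transport (ψ v).toMulEquiv (ψ v).continuous (ψ v).symm.continuous).IsAdmissibleOn
      fun γ => IsRegularElt (γ.val : GL (Fin 3) (UnitaryGroup.LocalRing L v))) ∧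
      ∀ (T : UnitaryGroup.PureTensor L 3 H)
        (T' : UnitaryGroup.PureTensor L 3 (Matrix.of fun i j : Fin 3 => if i.val + j.val + 1 = 3 then (1 : L) else 0)),
        (∀ v, T'.loc v = T.loc v ∘ (ψ v).symm) → ∀ v, IsLocalInnerTransfer L H v (m' v)
          ((m' v).transport (ψ v).toMulEquiv (ψ v).continuous (ψ v).symm.continuous) (T.loc v) (T'.loc v) :=
  ⟨forall_isAdmissibleOn_isRegularElt_transport L H ψ hcorr' hm', fun T T' hloc =>
    forall_isLocalInnerTransfer_transport L H ψ hcorr m' T T' hloc⟩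

end GivenFamily

end Literature.NumberTheory.Rogawski1990

end
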